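import Summits.CriticalPhenomena.PercolationContinuityZ3.Theorems.PercNearOneGluingNoHeavyLowerTailCubicThreePointRegimeShadow
import Mathlib.Tactic.Ring
import Mathlib.Tactic.Linarith
import Mathlib.Tactic.Positivity
import HarnessLib

/-!
# `NoHeavyLowerTail` (stmt-CriticalPhenomena-4575) — the shadow row `S₅ = t·Γ₂ + q·Γ₁ − e₃` is CLOSED under PARALLEL COMPOSITION
# (the K3-semigroup / join property of the cubic shadow; exact certificate with 562 product terms)

Support file (prover prim-ineq-gen-2 gen 10; `--supports stmt-CriticalPhenomena-4575`).  Pure real algebra, no definitions, no named facts,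
no sorries.  Vocabulary: `CubicThreePointApex.{Shad, Gam, Gam1, Gam2, SBHK, SdBHK, HarS, HarT}` (`…RegimeShadow`, `…ApexDecoupled`,
`…ApexSplit`), `CubicThreePointTerminal.AG`; REFINED cells (apex `a`) `(W, N′, U₁, U₂, U₃, N, M)`: `W ⊔ N′ = {a|b|c}` split by
'`V(C_a)` separates `b,c` in the support' (`N′`), `U₁ = ab|c`, `U₂ = ac|b`, `U₃ = bc|a`, `N ⊔ M = {abc}` split by '`b ~ c` in `ω ∖ a`' (`M`);
`q = W + N′`, `t = N + M`.

PARALLEL COMPOSITION (join at the three terminals of two independent 3-terminal networks with refined laws `x`, `y`).  The refined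
law `z` of the composite is BILINEAR: the partition of `{a,b,c}` is the join of the two partitions; `b ~ c` off `a` in the composite iff
it holds in one factor (a path avoiding `a` cannot switch networks); in the all-separated case `V(C_a) = V(C_a^x) ∪ V(C_a^y)` separates
`b, c` iff it does so in both supports.  Hence (`hz*` hypotheses): `zN′ = N′N₂′`, `zW = qQ − N′N₂′`, `zUᵢ = q vᵢ + uᵢ Q + uᵢvᵢ`,
`zM` = the `T`-pairs with a factor in `{U₃, M}`, `zN` = the remaining `T`-pairs (validated against the percolation engine on glued graphs,
memo run/shared/lean/prim/prim-ineq-gen-2/SHADOW-S5.md §10, lab/joinmap.py).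

THEOREM (`Shad_join_nonneg`).  If both factors have nonnegative cells and satisfy `S₅ ≥ 0` (the induction hypothesis; with the cells also
`S₅ᵃ = S₅(…,n,0) ≥ S₅` and `S₅ᵇ = S₅(…,0,n′) ≥ S₅`), Gladkov's `AG ≥ 0` and AG⁺ `= AG·σ − e₃ ≥ 0`, the refined rows `Γ₂, Γ ≥ 0`, the BHK slack
`S = u₁u₂ − qn ≥ 0` and the Harris covariance `H = (t−n)q − u₃(u₁+u₂+n) ≥ 0` (all THEOREMS on realizable laws), then `S₅(z) ≥ 0`.
Proof: the identity `2·S₅(z) = Σ_k c_k g_k(x) h_k(y)` with `c_k ∈ ℕ` and `g_k, h_k` products of cells and of the listed generators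
(562 terms; found by an LP over all bidegree-(3,3) products and rounded exactly, kit j094578; verified here by `ring`), after which every
term is nonnegative (`positivity`).  With `…RegimeShadowTerminalOps` (terminal chords / pendants) this makes `{S₅ ≥ 0}` closed under the
operations generating the parallel–terminal class (all `K_{3,m}` with terminal edges and pendant trees, …); `S₅ ≥ 0 ⟹ H_{q+t} ≥ 0`
(`Hqt_nonneg_of_Shad`).  STATUS of `S₅ ≥ 0` in general: conjectured (three-copy comb positive on all supports `≤ 5` vertices and every
larger support tested; SHADOW-S5.md).
-/

namespace Summit.CriticalPhenomena.PercolationContinuityZ3.Theorems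

namespace CubicThreePointApex

open CubicThreePointTerminal CubicThreePointSharp

set_option maxHeartbeats 40000000 in
set_option maxRecDepth 100000 in
/-- **`S₅` is closed under parallel composition** (refined join of two 3-terminal laws; hypotheses = nonnegative cells + the theorem rows
`AG, AG⁺, Γ₂, Γ, S_BHK, H` and the induction hypothesis `S₅ ≥ 0` on both factors). [this work] -/
theorem Shad_join_nonneg {W N' U₁ U₂ U₃ N M W₂ N₂' V₁ V₂ V₃ N₂ M₂ zW zN' zU₁ zU₂ zU₃ zN zM : ℝ}
    (h0x : 0 ≤ W) (h1x : 0 ≤ N') (h2x : 0 ≤ U₁) (h3x : 0 ≤ U₂) (h4x : 0 ≤ U₃) (h5x : 0 ≤ N) (h6x : 0 ≤ M) (h0y : 0 ≤ W₂) (h1y : 0 ≤ N₂') (h2y : 0 ≤ V₁) (h3y : 0 ≤ V₂) (h4y : 0 ≤ V₃) (h5y : 0 ≤ N₂) (h6y : 0 ≤ M₂)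
    (hAGx : 0 ≤ AG (W + N') U₁ U₂ U₃ (N + M)) (hAGpx : 0 ≤ (AG (W + N') U₁ U₂ U₃ (N + M) * (W + N' + U₁ + U₂ + U₃ + N + M) - U₁ * U₂ * U₃)) (hGx : 0 ≤ Gam (W + N') U₁ U₂ U₃ (N + M) N N') (hG2x : 0 ≤ Gam2 (W + N') U₁ U₂ U₃ (N + M) N) (hHx : 0 ≤ HarS (W + N') U₁ U₂ U₃ (N + M) N) (hSx : 0 ≤ SBHK (W + N') U₁ U₂ N) (hSHADx : 0 ≤ Shad (W + N') U₁ U₂ U₃ (N + M) N N') (hAGy : 0 ≤ AG (W₂ + N₂') V₁ V₂ V₃ (N₂ + M₂)) (hAGpy : 0 ≤ (AG (W₂ + N₂') V₁ V₂ V₃ (N₂ + M₂) * (W₂ + N₂' + V₁ + V₂ + V₃ + N₂ + M₂) - V₁ * V₂ * V₃)) (hGy : 0 ≤ Gam (W₂ + N₂') V₁ V₂ V₃ (N₂ + M₂) N₂ N₂') (hG2y : 0 ≤ Gam2 (W₂ + N₂') V₁ V₂ V₃ (N₂ + M₂) N₂) (hHy : 0 ≤ HarS (W₂ + N₂') V₁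 V₂ V₃ (N₂ + M₂) N₂) (hSy : 0 ≤ SBHK (W₂ + N₂') V₁ V₂ N₂) (hSHADy : 0 ≤ Shad (W₂ + N₂') V₁ V₂ V₃ (N₂ + M₂) N₂ N₂')
    (hzW : zW = W * W₂ + W * N₂' + N' * W₂)
    (hzNp : zN' = N' * N₂')
    (hzU₁ : zU₁ = W * V₁ + N' * V₁ + U₁ * W₂ + U₁ * N₂' + U₁ * V₁)
    (hzU₂ : zU₂ = W * V₂ + N' * V₂ + U₂ * W₂ + U₂ * N₂' + U₂ * V₂)
    (hzU₃ : zU₃ = W * V₃ + N' * V₃ + U₃ * W₂ + U₃ * N₂' + U₃ * V₃)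
    (hzN : zN = W * N₂ + N' * N₂ + U₁ * V₂ + U₁ * N₂ + U₂ * V₁ + U₂ * N₂ + N * W₂ + N * N₂' + N * V₁ + N * V₂ + N * N₂)
    (hzM : zM = W * M₂ + N' * M₂ + U₁ * V₃ + U₁ * M₂ + U₂ * V₃ + U₂ * M₂ + U₃ * V₁ + U₃ * V₂ + U₃ * N₂ + U₃ * M₂ + N * V₃ + N * M₂ + M * W₂ + M * N₂' + M * V₁ + M * V₂ + M * V₃ + M * N₂ + M * M₂) :
    0 ≤ Shad (zW + zN') zU₁ zU₂ zU₃ (zN + zM) zN zN' := by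
  have hSax : 0 ≤ Shad (W + N') U₁ U₂ U₃ (N + M) N 0 := by
    have e1 := Shad_eq_Hqt_sub (W + N') U₁ U₂ U₃ (N + M) N N'
    have e2 := Shad_eq_Hqt_sub (W + N') U₁ U₂ U₃ (N + M) N 0
    nlinarith [mul_nonneg h4x (mul_nonneg (add_nonneg h0x h1x) h1x)]
  have hSbx : 0 ≤ Shad (W + N') U₁ U₂ U₃ (N + M) 0 N' := by
    have e1 := Shad_eq_Hqt_sub (W + N') U₁ U₂ U₃ (N + M) N N'
    have e2 := Shad_eq_Hqt_sub (W + N') U₁ U₂ U₃ (N + M) 0 N'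
    nlinarith [mul_nonneg h4x (mul_nonneg (add_nonneg h5x h6x) h5x)]
  have hSay : 0 ≤ Shad (W₂ + N₂') V₁ V₂ V₃ (N₂ + M₂) N₂ 0 := by
    have e1 := Shad_eq_Hqt_sub (W₂ + N₂') V₁ V₂ V₃ (N₂ + M₂) N₂ N₂'
    have e2 := Shad_eq_Hqt_sub (W₂ + N₂') V₁ V₂ V₃ (N₂ + M₂) N₂ 0
    nlinarith [mul_nonneg h4y (mul_nonneg (add_nonneg h0y h1y) h1y)]
  have hSby : 0 ≤ Shad (W₂ + N₂') V₁ V₂ V₃ (N₂ + M₂) 0 N₂' := by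
    have e1 := Shad_eq_Hqt_sub (W₂ + N₂') V₁ V₂ V₃ (N₂ + M₂) N₂ N₂'
    have e2 := Shad_eq_Hqt_sub (W₂ + N₂') V₁ V₂ V₃ (N₂ + M₂) 0 N₂'
    nlinarith [mul_nonneg h4y (mul_nonneg (add_nonneg h5y h6y) h5y)]
  have key : 2 * Shad (zW + zN') zU₁ zU₂ zU₃ (zN + zM) zN zN' =
        (Shad (W + N') U₁ U₂ U₃ (N + M) N N') * (2 * (W₂ * W₂ * N₂') + 4 * (W₂ * N₂' * N₂') + 2 * (W₂ * N₂' * V₃) + 2 * (N₂' * N₂' * N₂') + 2 * (N₂' * N₂' * V₃))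
        + (Shad (W + N') U₁ U₂ U₃ (N + M) N 0) * (AG (W₂ + N₂') V₁ V₂ V₃ (N₂ + M₂) * V₁)
        + (Shad (W + N') U₁ U₂ U₃ (N + M) N 0) * (AG (W₂ + N₂') V₁ V₂ V₃ (N₂ + M₂) * V₂)
        + (Shad (W + N') U₁ U₂ U₃ (N + M) N 0) * (2 * (W₂ * W₂ * W₂) + 4 * (W₂ * W₂ * N₂') + 2 * (W₂ * W₂ * V₁) + 2 * (W₂ * W₂ * V₂) + 2 * (W₂ * W₂ * V₃) + 3 * (W₂ * W₂ * N₂) + 2 * (W₂ * W₂ * M₂) + 2 * (W₂ * N₂' * N₂') + 4 * (W₂ * N₂' * V₁) + 4 * (W₂ * N₂' * V₂) + 2 * (W₂ * N₂' * V₃) + 6 * (W₂ * N₂' * N₂) + 4 * (W₂ * N₂' * M₂) + (W₂ * V₁ * V₂) + 2 * (W₂ * V₁ * V₃) + (W₂ * V₁ * N₂) + 2 * (W₂ * V₂ * V₃) + (W₂ * V₂ * N₂) + (W₂ * V₃ * N₂) + (W₂ * N₂ * N₂) + 2 * (N₂' * N₂' * V₁) + 2 * (N₂' * N₂' * V₂)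 + 3 * (N₂' * N₂' * N₂) + 2 * (N₂' * N₂' * M₂) + (N₂' * V₁ * V₂) + 2 * (N₂' * V₁ * V₃) + (N₂' * V₁ * N₂) + 2 * (N₂' * V₂ * V₃) + (N₂' * V₂ * N₂) + (N₂' * V₃ * N₂) + (N₂' * N₂ * N₂) + (V₁ * V₁ * V₂) + 2 * (V₁ * V₁ * V₃) + (V₁ * V₂ * V₂) + 5 * (V₁ * V₂ * V₃) + (V₁ * V₂ * N₂) + (V₁ * V₂ * M₂) + 2 * (V₁ * V₃ * N₂) + 2 * (V₂ * V₂ * V₃) + 2 * (V₂ * V₃ * N₂) + (V₃ * N₂ * N₂))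
        + (Shad (W + N') U₁ U₂ U₃ (N + M) 0 N') * (SBHK (W₂ + N₂') V₁ V₂ N₂ * V₁)
        + (Shad (W + N') U₁ U₂ U₃ (N + M) 0 N') * (SBHK (W₂ + N₂') V₁ V₂ N₂ * V₂)
        + 2 * ((AG (W + N') U₁ U₂ U₃ (N + M) * (W + N' + U₁ + U₂ + U₃ + N + M) - U₁ * U₂ * U₃)) * (Gam2 (W₂ + N₂') V₁ V₂ V₃ (N₂ + M₂) N₂ * V₁)
        + 2 * ((AG (W + N') U₁ U₂ U₃ (N + M) * (W + N' + U₁ + U₂ + U₃ + N + M) - U₁ * U₂ * U₃)) * (Gam2 (W₂ + N₂') V₁ V₂ V₃ (N₂ + M₂) N₂ * V₂)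
        + ((AG (W + N') U₁ U₂ U₃ (N + M) * (W + N' + U₁ + U₂ + U₃ + N + M) - U₁ * U₂ * U₃)) * (HarS (W₂ + N₂') V₁ V₂ V₃ (N₂ + M₂) N₂ * W₂)
        + ((AG (W + N') U₁ U₂ U₃ (N + M) * (W + N' + U₁ + U₂ + U₃ + N + M) - U₁ * U₂ * U₃)) * (HarS (W₂ + N₂') V₁ V₂ V₃ (N₂ + M₂) N₂ * N₂')
        + 2 * ((AG (W + N') U₁ U₂ U₃ (N + M) * (W + N' + U₁ + U₂ + U₃ + N + M) - U₁ * U₂ * U₃)) * (HarS (W₂ + N₂') V₁ V₂ V₃ (N₂ + M₂) N₂ * V₃)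
        + 2 * ((AG (W + N') U₁ U₂ U₃ (N + M) * (W + N' + U₁ + U₂ + U₃ + N + M) - U₁ * U₂ * U₃)) * (HarS (W₂ + N₂') V₁ V₂ V₃ (N₂ + M₂) N₂ * N₂)
        + ((AG (W + N') U₁ U₂ U₃ (N + M) * (W + N' + U₁ + U₂ + U₃ + N + M) - U₁ * U₂ * U₃)) * (HarS (W₂ + N₂') V₁ V₂ V₃ (N₂ + M₂) N₂ * M₂)
        + 2 * (Gam2 (W + N') U₁ U₂ U₃ (N + M) N * U₁) * ((AG (W₂ + N₂') V₁ V₂ V₃ (N₂ + M₂) * (W₂ + N₂' + V₁ + V₂ + V₃ + N₂ + M₂) - V₁ * V₂ * V₃))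
        + (Gam2 (W + N') U₁ U₂ U₃ (N + M) N * U₁) * (AG (W₂ + N₂') V₁ V₂ V₃ (N₂ + M₂) * V₂)
        + (Gam2 (W + N') U₁ U₂ U₃ (N + M) N * U₁) * (2 * (W₂ * W₂ * V₂) + 2 * (W₂ * W₂ * V₃) + (W₂ * W₂ * N₂) + 4 * (W₂ * N₂' * V₂) + 2 * (W₂ * N₂' * V₃) + 2 * (W₂ * N₂' * N₂) + 3 * (W₂ * V₁ * V₂) + 4 * (W₂ * V₁ * V₃) + 2 * (W₂ * V₂ * V₂) + 4 * (W₂ * V₂ * V₃) + (W₂ * V₃ * N₂) + (W₂ * N₂ * N₂) + 2 * (N₂' * N₂' * V₂) + (N₂' * N₂' * N₂) + 3 * (N₂' * V₁ * V₂) + 3 * (N₂' * V₁ * V₃) + 2 * (N₂' * V₂ * V₂) + 4 * (N₂' * V₂ * V₃) + (N₂' * V₃ * N₂) + (N₂' * N₂ * N₂) + 2 * (V₁ * V₁ * V₂) + 2 * (V₁ * V₁ * V₃) + 4 * (V₁ * V₂ * V₂) + 7 * (V₁ * V₂ * V₃) + (V₁ * V₂ * N₂) + (V₁ * V₂ * M₂)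 + (V₁ * V₃ * N₂) + 2 * (V₂ * V₂ * V₃))
        + 2 * (Gam2 (W + N') U₁ U₂ U₃ (N + M) N * U₂) * ((AG (W₂ + N₂') V₁ V₂ V₃ (N₂ + M₂) * (W₂ + N₂' + V₁ + V₂ + V₃ + N₂ + M₂) - V₁ * V₂ * V₃))
        + (Gam2 (W + N') U₁ U₂ U₃ (N + M) N * U₂) * (AG (W₂ + N₂') V₁ V₂ V₃ (N₂ + M₂) * V₁)
        + (Gam2 (W + N') U₁ U₂ U₃ (N + M) N * U₂) * (2 * (W₂ * W₂ * V₁) + 2 * (W₂ * W₂ * V₃) + (W₂ * W₂ * N₂) + 4 * (W₂ * N₂' * V₁) + 4 * (W₂ * N₂' * V₃) + 2 * (W₂ * N₂' * N₂) + 2 * (W₂ * V₁ * V₁) + 3 * (W₂ * V₁ * V₂) + 4 * (W₂ * V₁ * V₃) + 4 * (W₂ * V₂ * V₃) + (W₂ * V₃ * N₂) + (W₂ * N₂ * N₂) + 2 * (N₂' * N₂' * V₁) + 2 * (N₂' * N₂' * V₃) + (N₂' * N₂' * N₂) + 2 * (N₂' * V₁ * V₁) + 3 * (N₂' * V₁ *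 V₂) + 4 * (N₂' * V₁ * V₃) + 4 * (N₂' * V₂ * V₃) + (N₂' * V₃ * N₂) + (N₂' * N₂ * N₂) + 4 * (V₁ * V₁ * V₂) + 2 * (V₁ * V₁ * V₃) + 2 * (V₁ * V₂ * V₂) + 7 * (V₁ * V₂ * V₃) + (V₁ * V₂ * N₂) + (V₁ * V₂ * M₂) + 2 * (V₂ * V₂ * V₃))
        + (Gam2 (W + N') U₁ U₂ U₃ (N + M) N * U₃) * (2 * (W₂ * W₂ * V₁) + 2 * (W₂ * W₂ * V₂) + 4 * (W₂ * N₂' * V₁) + 4 * (W₂ * N₂' * V₂) + 2 * (W₂ * V₁ * V₁) + 4 * (W₂ * V₁ * V₂) + 2 * (W₂ * V₂ * V₂) + 2 * (N₂' * N₂' * V₁) + 2 * (N₂' * N₂' * V₂) + 2 * (N₂' * V₁ * V₁) + 4 * (N₂' * V₁ * V₂) + 2 * (N₂' * V₂ * V₂) + 2 * (V₁ * V₁ * V₂) + 2 * (V₁ * V₂ * V₂))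
        + (Gam2 (W + N') U₁ U₂ U₃ (N + M) N * N) * (2 * (W₂ * W₂ * V₁) + 2 * (W₂ * W₂ * V₂) + 4 * (W₂ * N₂' * V₁) + 4 * (W₂ * N₂' * V₂) + 2 * (W₂ * V₁ * V₁) + 4 * (W₂ * V₁ * V₂) + 2 * (W₂ * V₂ * V₂) + 2 * (N₂' * N₂' * V₁) + 2 * (N₂' * N₂' * V₂) + 2 * (N₂' * V₁ * V₁) + 4 * (N₂' * V₁ * V₂) + 2 * (N₂' * V₂ * V₂) + 2 * (V₁ * V₁ * V₂) + 2 * (V₁ * V₂ * V₂))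
        + (Gam2 (W + N') U₁ U₂ U₃ (N + M) N * M) * (2 * (W₂ * W₂ * V₁) + 2 * (W₂ * W₂ * V₂) + 4 * (W₂ * N₂' * V₁) + 4 * (W₂ * N₂' * V₂) + (W₂ * N₂' * V₃) + 2 * (W₂ * V₁ * V₁) + 4 * (W₂ * V₁ * V₂) + 2 * (W₂ * V₂ * V₂) + 2 * (N₂' * N₂' * V₁) + 2 * (N₂' * N₂' * V₂) + (N₂' * N₂' * V₃) + 2 * (N₂' * V₁ * V₁) + 4 * (N₂' * V₁ * V₂) + 2 * (N₂' * V₂ * V₂) + 2 * (V₁ * V₁ * V₂) + 2 * (V₁ * V₂ * V₂))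
        + (Gam (W + N') U₁ U₂ U₃ (N + M) N N' * U₂) * ((V₂ * V₃ * N₂))
        + (AG (W + N') U₁ U₂ U₃ (N + M) * U₁) * (Shad (W₂ + N₂') V₁ V₂ V₃ (N₂ + M₂) N₂ 0)
        + (AG (W + N') U₁ U₂ U₃ (N + M) * U₁) * (Gam2 (W₂ + N₂') V₁ V₂ V₃ (N₂ + M₂) N₂ * V₂)
        + (AG (W + N') U₁ U₂ U₃ (N + M) * U₁) * ((W₂ * N₂' * V₃) + (N₂' * N₂' * V₃) + (N₂' * V₁ * V₃))
        + (AG (W + N') U₁ U₂ U₃ (N + M) * U₂) * (Shad (W₂ + N₂') V₁ V₂ V₃ (N₂ + M₂) N₂ 0)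
        + (AG (W + N') U₁ U₂ U₃ (N + M) * U₂) * (Gam2 (W₂ + N₂') V₁ V₂ V₃ (N₂ + M₂) N₂ * V₁)
        + (AG (W + N') U₁ U₂ U₃ (N + M) * U₃) * (HarS (W₂ + N₂') V₁ V₂ V₃ (N₂ + M₂) N₂ * W₂)
        + (AG (W + N') U₁ U₂ U₃ (N + M) * U₃) * (HarS (W₂ + N₂') V₁ V₂ V₃ (N₂ + M₂) N₂ * N₂')
        + 2 * (AG (W + N') U₁ U₂ U₃ (N + M) * U₃) * (HarS (W₂ + N₂') V₁ V₂ V₃ (N₂ + M₂) N₂ * V₁)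
        + 2 * (AG (W + N') U₁ U₂ U₃ (N + M) * U₃) * (HarS (W₂ + N₂') V₁ V₂ V₃ (N₂ + M₂) N₂ * V₂)
        + (AG (W + N') U₁ U₂ U₃ (N + M) * U₃) * (HarS (W₂ + N₂') V₁ V₂ V₃ (N₂ + M₂) N₂ * M₂)
        + (HarS (W + N') U₁ U₂ U₃ (N + M) N * W) * ((AG (W₂ + N₂') V₁ V₂ V₃ (N₂ + M₂) * (W₂ + N₂' + V₁ + V₂ + V₃ + N₂ + M₂) - V₁ * V₂ * V₃))
        + (HarS (W + N') U₁ U₂ U₃ (N + M) N * W) * (AG (W₂ + N₂') V₁ V₂ V₃ (N₂ + M₂) * V₃)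
        + (HarS (W + N') U₁ U₂ U₃ (N + M) N * W) * (2 * (V₁ * V₂ * V₃) + 2 * (V₁ * V₃ * V₃) + (V₁ * V₃ * N₂) + 2 * (V₁ * V₃ * M₂) + 2 * (V₂ * V₃ * V₃) + (V₂ * V₃ * N₂) + 2 * (V₂ * V₃ * M₂) + (V₃ * N₂ * N₂) + (V₃ * N₂ * M₂))
        + (HarS (W + N') U₁ U₂ U₃ (N + M) N * N') * ((AG (W₂ + N₂') V₁ V₂ V₃ (N₂ + M₂) * (W₂ + N₂' + V₁ + V₂ + V₃ + N₂ + M₂) - V₁ * V₂ * V₃))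
        + (HarS (W + N') U₁ U₂ U₃ (N + M) N * N') * (AG (W₂ + N₂') V₁ V₂ V₃ (N₂ + M₂) * V₃)
        + (HarS (W + N') U₁ U₂ U₃ (N + M) N * N') * (2 * (V₁ * V₂ * V₃) + 2 * (V₁ * V₃ * V₃) + (V₁ * V₃ * N₂) + 2 * (V₁ * V₃ * M₂) + 2 * (V₂ * V₃ * V₃) + (V₂ * V₃ * N₂) + 2 * (V₂ * V₃ * M₂) + (V₃ * N₂ * N₂) + (V₃ * N₂ * M₂))
        + 2 * (HarS (W + N') U₁ U₂ U₃ (N + M) N * U₁) * (AG (W₂ + N₂') V₁ V₂ V₃ (N₂ + M₂) * V₃)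
        + (HarS (W + N') U₁ U₂ U₃ (N + M) N * U₁) * ((W₂ * N₂' * V₃) + 2 * (W₂ * V₂ * V₃) + 2 * (W₂ * V₃ * V₃) + (N₂' * N₂' * V₃) + 2 * (N₂' * V₂ * V₃) + 2 * (N₂' * V₃ * V₃) + 4 * (V₁ * V₂ * V₃) + 4 * (V₁ * V₃ * V₃) + 2 * (V₁ * V₃ * N₂) + 2 * (V₁ * V₃ * M₂) + 2 * (V₂ * V₂ * V₃) + 4 * (V₂ * V₃ * V₃) + 4 * (V₂ * V₃ * N₂) + 2 * (V₂ * V₃ * M₂) + (V₃ * N₂ * N₂))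
        + 2 * (HarS (W + N') U₁ U₂ U₃ (N + M) N * U₂) * (AG (W₂ + N₂') V₁ V₂ V₃ (N₂ + M₂) * V₃)
        + (HarS (W + N') U₁ U₂ U₃ (N + M) N * U₂) * (2 * (W₂ * V₁ * V₃) + 2 * (W₂ * V₃ * V₃) + 2 * (N₂' * V₁ * V₃) + 2 * (N₂' * V₃ * V₃) + 2 * (V₁ * V₁ * V₃) + 4 * (V₁ * V₂ * V₃) + 4 * (V₁ * V₃ * V₃) + 4 * (V₁ * V₃ * N₂) + 2 * (V₁ * V₃ * M₂) + 4 * (V₂ * V₃ * V₃) + 2 * (V₂ * V₃ * N₂) + 2 * (V₂ * V₃ * M₂) + (V₃ * N₂ * N₂))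
        + 2 * (HarS (W + N') U₁ U₂ U₃ (N + M) N * U₃) * ((AG (W₂ + N₂') V₁ V₂ V₃ (N₂ + M₂) * (W₂ + N₂' + V₁ + V₂ + V₃ + N₂ + M₂) - V₁ * V₂ * V₃))
        + (HarS (W + N') U₁ U₂ U₃ (N + M) N * U₃) * (2 * (W₂ * V₁ * V₂) + 4 * (W₂ * V₁ * V₃) + 4 * (W₂ * V₂ * V₃) + 2 * (N₂' * V₁ * V₂) + 4 * (N₂' * V₁ * V₃) + 4 * (N₂' * V₂ * V₃) + 2 * (V₁ * V₁ * V₂) + 4 * (V₁ * V₁ * V₃) + 2 * (V₁ * V₂ * V₂) + 12 * (V₁ * V₂ * V₃) + 2 * (V₁ * V₂ * N₂) + 2 * (V₁ * V₂ * M₂) + 2 * (V₁ * V₃ * V₃) + 4 * (V₁ * V₃ * N₂) + 2 * (V₁ * V₃ * M₂) + 4 * (V₂ * V₂ * V₃) + 2 * (V₂ * V₃ * V₃) + 4 * (V₂ * V₃ * N₂) + 2 * (V₂ * V₃ * M₂))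
        + 2 * (HarS (W + N') U₁ U₂ U₃ (N + M) N * N) * ((AG (W₂ + N₂') V₁ V₂ V₃ (N₂ + M₂) * (W₂ + N₂' + V₁ + V₂ + V₃ + N₂ + M₂) - V₁ * V₂ * V₃))
        + (HarS (W + N') U₁ U₂ U₃ (N + M) N * N) * (2 * (W₂ * W₂ * V₃) + 3 * (W₂ * N₂' * V₃) + 4 * (W₂ * V₁ * V₃) + 4 * (W₂ * V₂ * V₃) + 2 * (W₂ * V₃ * V₃) + 2 * (W₂ * V₃ * N₂) + (N₂' * N₂' * V₃) + 4 * (N₂' * V₁ * V₃) + 4 * (N₂' * V₂ * V₃) + 2 * (N₂' * V₃ * V₃) + 2 * (N₂' * V₃ * N₂) + 2 * (V₁ * V₁ * V₃) + 6 * (V₁ * V₂ * V₃) + 4 * (V₁ * V₃ * V₃) + 2 * (V₁ * V₃ * N₂) + 2 * (V₁ * V₃ * M₂) + 2 * (V₂ * V₂ * V₃) + 4 * (V₂ * V₃ * V₃) + 2 * (V₂ * V₃ * N₂) + 2 * (V₂ * V₃ * M₂) + 2 * (V₃ * V₃ * N₂))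
        + (HarS (W + N') U₁ U₂ U₃ (N + M) N * M) * ((AG (W₂ + N₂') V₁ V₂ V₃ (N₂ + M₂) * (W₂ + N₂' + V₁ + V₂ + V₃ + N₂ + M₂) - V₁ * V₂ * V₃))
        + (HarS (W + N') U₁ U₂ U₃ (N + M) N * M) * (2 * (W₂ * W₂ * V₃) + 3 * (W₂ * N₂' * V₃) + 4 * (W₂ * V₁ * V₃) + 4 * (W₂ * V₂ * V₃) + 2 * (W₂ * V₃ * V₃) + 3 * (W₂ * V₃ * N₂) + (W₂ * V₃ * M₂) + (N₂' * N₂' * V₃) + 4 * (N₂' * V₁ * V₃) + 4 * (N₂' * V₂ * V₃) + 2 * (N₂' * V₃ * V₃) + 3 * (N₂' * V₃ * N₂) + (N₂' * V₃ * M₂) + 2 * (V₁ * V₁ * V₃) + 5 * (V₁ * V₂ * V₃) + 3 * (V₁ * V₃ * V₃) + 3 * (V₁ * V₃ * N₂) + 2 * (V₁ * V₃ * M₂) + 2 * (V₂ * V₂ * V₃) + 3 * (V₂ * V₃ * V₃) + 3 * (V₂ * V₃ * N₂) + 2 * (V₂ * V₃ * M₂) + 2 * (V₃ * V₃ * N₂)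 + (V₃ * N₂ * N₂) + (V₃ * N₂ * M₂))
        + (SBHK (W + N') U₁ U₂ N * U₁) * (Shad (W₂ + N₂') V₁ V₂ V₃ (N₂ + M₂) 0 N₂')
        + (SBHK (W + N') U₁ U₂ N * U₁) * (2 * (V₃ * V₃ * N₂) + (V₃ * N₂ * M₂))
        + (SBHK (W + N') U₁ U₂ N * U₂) * (2 * (V₃ * V₃ * N₂) + (V₃ * N₂ * N₂) + 2 * (V₃ * N₂ * M₂))
        + (2 * (W * W * W) + 4 * (W * W * N') + 2 * (W * W * U₁) + 2 * (W * W * U₂) + 2 * (W * W * U₃) + 3 * (W * W * N) + 2 * (W * W * M) + 2 * (W * N' * N') + 4 * (W * N' * U₁) + 4 * (W * N' * U₂) + 4 * (W * N' * U₃) + 6 * (W * N' * N) + 4 * (W * N' * M) + (W * U₁ * U₂) + 2 * (W * U₁ * U₃) + (W * U₁ * N) + 2 * (W * U₂ * U₃) + (W * U₃ * N) + (W * N * N) + 2 * (N' * N' * U₁) + 2 * (N' * N' * U₂) + 2 * (N' * N' * U₃) + 3 * (N' * N' * N) + 2 * (N' * N' * M) + (N' * U₁ * U₂) + 2 * (N'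 * U₁ * U₃) + (N' * U₁ * N) + 2 * (N' * U₂ * U₃) + (N' * U₃ * N) + (N' * N * N) + (U₁ * U₁ * U₂) + 2 * (U₁ * U₁ * U₃) + 2 * (U₁ * U₂ * U₂) + 5 * (U₁ * U₂ * U₃) + (U₁ * U₂ * N) + (U₁ * U₂ * M) + 2 * (U₂ * U₂ * U₃) + (U₂ * U₃ * N)) * (Shad (W₂ + N₂') V₁ V₂ V₃ (N₂ + M₂) N₂ 0)
        + (2 * (W * W * N') + 4 * (W * N' * N') + 2 * (N' * N' * N') + 2 * (U₁ * U₃ * N) + (U₂ * U₃ * N) + (U₃ * N * N)) * (Shad (W₂ + N₂') V₁ V₂ V₃ (N₂ + M₂) N₂ N₂')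
        + (2 * (W * W * U₁) + 2 * (W * W * U₃) + (W * W * N) + 4 * (W * N' * U₁) + 3 * (W * N' * U₃) + 2 * (W * N' * N) + 2 * (W * U₁ * U₁) + 3 * (W * U₁ * U₂) + 4 * (W * U₁ * U₃) + 4 * (W * U₂ * U₃) + (W * U₃ * N) + (W * N * N) + 2 * (N' * N' * U₁) + (N' * N' * U₃) + (N' * N' * N) + 2 * (N' * U₁ * U₁) + 3 * (N' * U₁ * U₂) + 4 * (N' * U₁ * U₃) + 3 * (N' * U₂ * U₃) + (N' * U₃ * N) + (N' * N * N) + 4 * (U₁ * U₁ * U₂) + 2 * (U₁ * U₁ * U₃) + 2 * (U₁ * U₂ * U₂) + 7 * (U₁ * U₂ * U₃) + (U₁ * U₂ * N) + (U₁ * U₂ * M) + 2 * (U₂ * U₂ * U₃) + (U₂ * U₃ * N)) * (Gam2 (W₂ + N₂') V₁ V₂ V₃ (N₂ + M₂) N₂ * V₂)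
        + (2 * (W * W * U₁) + 2 * (W * W * U₂) + 4 * (W * N' * U₁) + 4 * (W * N' * U₂) + 2 * (W * U₁ * U₁) + 4 * (W * U₁ * U₂) + 2 * (W * U₂ * U₂) + 2 * (N' * N' * U₁) + 2 * (N' * N' * U₂) + 2 * (N' * U₁ * U₁) + 4 * (N' * U₁ * U₂) + 2 * (N' * U₂ * U₂) + 2 * (U₁ * U₁ * U₂) + 2 * (U₁ * U₂ * U₂)) * (Gam2 (W₂ + N₂') V₁ V₂ V₃ (N₂ + M₂) N₂ * V₃)
        + (2 * (W * W * U₁) + 2 * (W * W * U₂) + 4 * (W * N' * U₁) + 4 * (W * N' * U₂) + 2 * (W * U₁ * U₁) + 4 * (W * U₁ * U₂) + 2 * (W * U₂ * U₂) + 2 * (N' * N' * U₁) + 2 * (N' * N' * U₂) + 2 * (N' * U₁ * U₁) + 4 * (N' * U₁ * U₂) + 2 * (N' * U₂ * U₂) + 2 * (U₁ * U₁ * U₂) + 2 * (U₁ * U₂ * U₂)) * (Gam2 (W₂ + N₂') V₁ V₂ V₃ (N₂ + M₂) N₂ * N₂)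
        + (2 * (W * W * U₁) + 2 * (W * W * U₂) + 4 * (W * N' * U₁) + 4 * (W * N' * U₂) + 2 * (W * U₁ * U₁) + 4 * (W * U₁ * U₂) + 2 * (W * U₂ * U₂) + 2 * (N' * N' * U₁) + 2 * (N' * N' * U₂) + 2 * (N' * U₁ * U₁) + 4 * (N' * U₁ * U₂) + 2 * (N' * U₂ * U₂) + 2 * (U₁ * U₁ * U₂) + 2 * (U₁ * U₂ * U₂)) * (Gam2 (W₂ + N₂') V₁ V₂ V₃ (N₂ + M₂) N₂ * M₂)
        + (2 * (W * W * U₂) + 2 * (W * W * U₃) + (W * W * N) + 4 * (W * N' * U₂) + 3 * (W * N' * U₃) + 2 * (W * N' * N) + 3 * (W * U₁ * U₂) + 4 * (W * U₁ * U₃) + 2 * (W * U₂ * U₂) + 4 * (W * U₂ * U₃) + (W * U₃ * N) + (W * N * N) + 2 * (N' * N' * U₂) + (N' * N' * U₃) + (N' * N' * N) + 3 * (N' * U₁ * U₂) + 4 * (N' * U₁ * U₃) + 2 * (N' * U₂ * U₂) + 4 * (N' * U₂ * U₃) + (N' * U₃ * N) + (N' * N * N) + 2 * (U₁ * U₁ *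 U₂) + 2 * (U₁ * U₁ * U₃) + 4 * (U₁ * U₂ * U₂) + 7 * (U₁ * U₂ * U₃) + (U₁ * U₂ * N) + (U₁ * U₂ * M) + 2 * (U₂ * U₂ * U₃)) * (Gam2 (W₂ + N₂') V₁ V₂ V₃ (N₂ + M₂) N₂ * V₁)
        + (2 * (W * W * U₃) + 4 * (W * N' * U₃) + 4 * (W * U₁ * U₃) + 4 * (W * U₂ * U₃) + 2 * (W * U₃ * U₃) + 2 * (W * U₃ * N) + 2 * (N' * N' * U₃) + 4 * (N' * U₁ * U₃) + 4 * (N' * U₂ * U₃) + 2 * (N' * U₃ * U₃) + 2 * (N' * U₃ * N) + 2 * (U₁ * U₁ * U₃) + 6 * (U₁ * U₂ * U₃) + 4 * (U₁ * U₃ * U₃) + 2 * (U₁ * U₃ * N) + 2 * (U₁ * U₃ * M) + 2 * (U₂ * U₂ * U₃) + 4 * (U₂ * U₃ * U₃) + 2 * (U₂ * U₃ * N) + 2 * (U₂ * U₃ * M) + 2 * (U₃ * U₃ * N)) * (HarS (W₂ + N₂') V₁ V₂ V₃ (N₂ + M₂) N₂ * N₂)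
        + (2 * (W * W * U₃) + 4 * (W * N' * U₃) + 4 * (W * U₁ * U₃) + 4 * (W * U₂ * U₃) + 2 * (W * U₃ * U₃) + 2 * (W * U₃ * N) + 2 * (N' * N' * U₃) + 4 * (N' * U₁ * U₃) + 4 * (N' * U₂ * U₃) + 2 * (N' * U₃ * U₃) + 2 * (N' * U₃ * N) + 2 * (U₁ * U₁ * U₃) + 6 * (U₁ * U₂ * U₃) + 4 * (U₁ * U₃ * U₃) + 3 * (U₁ * U₃ * N) + 2 * (U₁ * U₃ * M) + 2 * (U₂ * U₂ * U₃) + 4 * (U₂ * U₃ * U₃) + 3 * (U₂ * U₃ * N) + 2 * (U₂ * U₃ * M) + 2 * (U₃ * U₃ * N) + (U₃ * N * N) + (U₃ * N * M)) * (HarS (W₂ + N₂') V₁ V₂ V₃ (N₂ + M₂) N₂ * M₂)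
        + ((W * N' * U₃) + 2 * (W * U₂ * U₃) + 2 * (W * U₃ * U₃) + (N' * N' * U₃) + 2 * (N' * U₂ * U₃) + 2 * (N' * U₃ * U₃) + 4 * (U₁ * U₂ * U₃) + 4 * (U₁ * U₃ * U₃) + 2 * (U₁ * U₃ * N) + 2 * (U₁ * U₃ * M) + 2 * (U₂ * U₂ * U₃) + 4 * (U₂ * U₃ * U₃) + 4 * (U₂ * U₃ * N) + 2 * (U₂ * U₃ * M) + (U₃ * N * N)) * (HarS (W₂ + N₂') V₁ V₂ V₃ (N₂ + M₂) N₂ * V₁)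
        + ((W * N' * U₃) + 2 * (W * U₁ * U₃) + 2 * (W * U₃ * U₃) + (N' * N' * U₃) + 2 * (N' * U₁ * U₃) + 2 * (N' * U₃ * U₃) + 2 * (U₁ * U₁ * U₃) + 4 * (U₁ * U₂ * U₃) + 4 * (U₁ * U₃ * U₃) + 4 * (U₁ * U₃ * N) + 2 * (U₁ * U₃ * M) + 4 * (U₂ * U₃ * U₃) + 2 * (U₂ * U₃ * N) + 2 * (U₂ * U₃ * M) + (U₃ * N * N)) * (HarS (W₂ + N₂') V₁ V₂ V₃ (N₂ + M₂) N₂ * V₂)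
        + (2 * (W * U₁ * U₂) + 4 * (W * U₁ * U₃) + 4 * (W * U₂ * U₃) + 2 * (N' * U₁ * U₂) + 4 * (N' * U₁ * U₃) + 4 * (N' * U₂ * U₃) + 2 * (U₁ * U₁ * U₂) + 4 * (U₁ * U₁ * U₃) + 2 * (U₁ * U₂ * U₂) + 12 * (U₁ * U₂ * U₃) + 2 * (U₁ * U₂ * N) + 2 * (U₁ * U₂ * M) + 2 * (U₁ * U₃ * U₃) + 4 * (U₁ * U₃ * N) + 2 * (U₁ * U₃ * M) + 4 * (U₂ * U₂ * U₃) + 2 * (U₂ * U₃ * U₃) + 4 * (U₂ * U₃ * N) + 2 * (U₂ * U₃ * M)) * (HarS (W₂ + N₂') V₁ V₂ V₃ (N₂ + M₂) N₂ * V₃)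
        + ((N' * U₂ * U₃)) * (AG (W₂ + N₂') V₁ V₂ V₃ (N₂ + M₂) * V₂)
        + (2 * (U₁ * U₂ * U₃) + 2 * (U₁ * U₃ * U₃) + (U₁ * U₃ * N) + 2 * (U₁ * U₃ * M) + 2 * (U₂ * U₃ * U₃) + (U₂ * U₃ * N) + 2 * (U₂ * U₃ * M) + (U₃ * N * N) + (U₃ * N * M)) * (HarS (W₂ + N₂') V₁ V₂ V₃ (N₂ + M₂) N₂ * W₂)
        + (2 * (U₁ * U₂ * U₃) + 2 * (U₁ * U₃ * U₃) + (U₁ * U₃ * N) + 2 * (U₁ * U₃ * M) + 2 * (U₂ * U₃ * U₃) + (U₂ * U₃ * N) + 2 * (U₂ * U₃ * M) + (U₃ * N * N) + (U₃ * N * M)) * (HarS (W₂ + N₂') V₁ V₂ V₃ (N₂ + M₂) N₂ * N₂')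
        + ((U₁ * U₂ * M) * (W₂ * N₂' * V₃) + (U₁ * U₂ * M) * (N₂' * N₂' * V₃))
        + ((U₁ * U₃ * N)) * (Gam (W₂ + N₂') V₁ V₂ V₃ (N₂ + M₂) N₂ N₂' * V₁)
        + (2 * (U₃ * U₃ * N) + (U₃ * N * M)) * (SBHK (W₂ + N₂') V₁ V₂ N₂ * V₁)
        + (2 * (U₃ * U₃ * N) + (U₃ * N * M)) * (SBHK (W₂ + N₂') V₁ V₂ N₂ * V₂) := by
    subst hzW hzNp hzU₁ hzU₂ hzU₃ hzN hzM
    simp only [Shad, Gam2, Gam1, Gam, SBHK, HarS, AG]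
    ring
  have hR : 0 ≤ 2 * Shad (zW + zN') zU₁ zU₂ zU₃ (zN + zM) zN zN' := by
    rw [key]
    generalize (AG (W + N') U₁ U₂ U₃ (N + M) * (W + N' + U₁ + U₂ + U₃ + N + M) - U₁ * U₂ * U₃) = A1 at hAGpx ⊢
    generalize (AG (W₂ + N₂') V₁ V₂ V₃ (N₂ + M₂) * (W₂ + N₂' + V₁ + V₂ + V₃ + N₂ + M₂) - V₁ * V₂ * V₃) = A10 at hAGpy ⊢
    generalize AG (W + N') U₁ U₂ U₃ (N + M) = A0 at hAGx ⊢
    generalize Gam (W + N') U₁ U₂ U₃ (N + M) N N' = A2 at hGx ⊢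
    generalize Gam2 (W + N') U₁ U₂ U₃ (N + M) N = A3 at hG2x ⊢
    generalize HarS (W + N') U₁ U₂ U₃ (N + M) N = A4 at hHx ⊢
    generalize SBHK (W + N') U₁ U₂ N = A5 at hSx ⊢
    generalize Shad (W + N') U₁ U₂ U₃ (N + M) N N' = A6 at hSHADx ⊢
    generalize Shad (W + N') U₁ U₂ U₃ (N + M) N 0 = A7 at hSax ⊢
    generalize Shad (W + N') U₁ U₂ U₃ (N + M) 0 N' = A8 at hSbx ⊢
    generalize AG (W₂ + N₂') V₁ V₂ V₃ (N₂ + M₂) = A9 at hAGy ⊢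
    generalize Gam (W₂ + N₂') V₁ V₂ V₃ (N₂ + M₂) N₂ N₂' = A11 at hGy ⊢
    generalize Gam2 (W₂ + N₂') V₁ V₂ V₃ (N₂ + M₂) N₂ = A12 at hG2y ⊢
    generalize HarS (W₂ + N₂') V₁ V₂ V₃ (N₂ + M₂) N₂ = A13 at hHy ⊢
    generalize SBHK (W₂ + N₂') V₁ V₂ N₂ = A14 at hSy ⊢
    generalize Shad (W₂ + N₂') V₁ V₂ V₃ (N₂ + M₂) N₂ N₂' = A15 at hSHADy ⊢
    generalize Shad (W₂ + N₂') V₁ V₂ V₃ (N₂ + M₂) N₂ 0 = A16 at hSay ⊢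
    generalize Shad (W₂ + N₂') V₁ V₂ V₃ (N₂ + M₂) 0 N₂' = A17 at hSby ⊢
    positivity
  linarith

end CubicThreePointApex

end Summit.CriticalPhenomena.PercolationContinuityZ3.Theorems
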